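import Summits.KontsevichZagierPeriods.KontsevichZagierPeriods.Theses.LiouvilleUnfolding
import Summits.KontsevichZagierPeriods.KontsevichZagierPeriods.Cruxes.LogKernelConjecture.Disproof
import Literature.NumberTheory.Transcendental.NesterenkoCriterion
import Literature.NumberTheory.Transcendental.KZVolumeConjectureProofs

/-!
# Sketch for crux idea `derivable-small-forms` (crux stmt-KontsevichZagierPeriods-2837, LogKernelConjecture)

First-lemma sketches only (crux-ideate stage: they must ELABORATE, not be proved).
-/

noncomputable section

open MeasureTheory Set Filter Topology
open Literature.NumberTheory.Transcendental

namespace Summit.KontsevichZagierPeriods.KontsevichZagierPeriods.Cruxes.LogKernelConjecture.DerivableSmallForms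

open Summit.KontsevichZagierPeriods.KontsevichZagierPeriods.Theses.LiouvilleUnfolding (LogKernelConjecture)
open Summit.KontsevichZagierPeriods.KontsevichZagierPeriods.Cruxes.LogKernelConjecture.Disproof
  (logClosure logClosure_le_ker relations_le_logClosure mem_logClosure_of_nsmul_mem
    logKernelConjecture_iff_ker_le)

/-- The value of a graded representation `⟨n, r⟩`. -/
def val (r : Σ n, KZ.IntegralRep n) : ℝ := r.2.value

/-- BOX INDEPENDENCE (the rank form of the crux): every finite family of integral representations
whose classes are `ℤ`-linearly independent in the five-rule quotient `FormalRep ⧸ logClosure` has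
`ℚ`-linearly independent VALUES. -/
def BoxIndependence : Prop :=
  ∀ (N : ℕ) (r : Fin N → Σ n, KZ.IntegralRep n),
    LinearIndependent ℤ (fun i => (QuotientAddGroup.mk (KZ.of (r i).2) : KZ.FormalRep ⧸ logClosure)) →
    LinearIndependent ℚ (fun i => val (r i))

/-- FIRST LEMMA (transfer, provable: finite support of a kernel element, a maximal independent
subfamily of its generators, torsion-freeness of the quotient `mem_logClosure_of_nsmul_mem` (§8 of
Disproof.lean), and `logKernelConjecture_iff_ker_le`). -/
theorem logKernelConjecture_of_boxIndependence (h : BoxIndependence) : LogKernelConjecture := by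
  sorry

/-- The transfer is an equivalence (sanity: the rank form is not a strengthening). -/
theorem boxIndependence_of_logKernelConjecture (h : LogKernelConjecture) : BoxIndependence := by
  sorry

/-- DERIVABLE SMALL POSITIVE FORMS for a family `r` (the engine's input, Nesterenko exact-rate
shape): integer coefficient sequences `p k i`, a sequence of single POSITIVE representations
`I k`, and rates `0 < α < 1 < β`, such that (i) the identity `∑ᵢ p k i • [r i] ∼ [I k]` is a
derivation of the five-rule calculus (membership in `logClosure`), (ii) `I k` has positive
integrand on a domain of positive measure (so its value is `> 0`: non-vanishing is POSITIVITY, not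
arithmetic), (iii) `log (value (I k)) / k → log α` and `log |p k i| ≤ k log β + o(k)`, and (iv) the
quality beats the size of the family: `N - 1 < 1 - log α / log β`. -/
def DerivableSmallForms (N : ℕ) (r : Fin N → Σ n, KZ.IntegralRep n) : Prop :=
  ∃ (p : ℕ → Fin N → ℤ) (I : ℕ → Σ n, KZ.IntegralRep n) (α β : ℝ),
    0 < α ∧ α < 1 ∧ 1 < β ∧
    (∀ k, (∑ i, p k i • KZ.of (r i).2) - KZ.of (I k).2 ∈ logClosure) ∧
    (∀ k, ∀ x ∈ (I k).2.domain, 0 < (I k).2.integrand x) ∧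
    (∀ k, 0 < volume (I k).2.domain) ∧
    Tendsto (fun k : ℕ => Real.log (val (I k)) / k) atTop (𝓝 (Real.log α)) ∧
    (∀ i, ∀ ε : ℝ, 0 < ε → ∀ᶠ k : ℕ in atTop, Real.log |(p k i : ℝ)| ≤ k * Real.log β + ε * k) ∧
    ((N : ℝ) - 1 < 1 - Real.log α / Real.log β)

/-- SECOND LEMMA (engine, provable from `nesterenko_criterion` + soundness `logClosure ≤ ker eval`
+ positivity of the integral): derivable small positive forms force `ℚ`-linear independence of the
values of the family. -/
theorem linearIndependent_val_of_derivableSmallForms {N : ℕ} (r : Fin N → Σ n, KZ.IntegralRep n)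
    (h : DerivableSmallForms N r) : LinearIndependent ℚ (fun i => val (r i)) := by
  sorry

/-- BOX SATURATION (the open core, Diophantine form of the crux): every `ℤ`-independent family
admits derivable small positive forms. With the two lemmas above it implies the crux. -/
def BoxSaturation : Prop :=
  ∀ (N : ℕ) (r : Fin N → Σ n, KZ.IntegralRep n),
    LinearIndependent ℤ (fun i => (QuotientAddGroup.mk (KZ.of (r i).2) : KZ.FormalRep ⧸ logClosure)) →
    DerivableSmallForms N r

/-- Composition (term-mode, no sorry beyond the two lemmas). -/
theorem logKernelConjecture_of_boxSaturation (h : BoxSaturation) : LogKernelConjecture :=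
  logKernelConjecture_of_boxIndependence fun N r hr =>
    linearIndependent_val_of_derivableSmallForms r (h N r hr)

/-- CALIBRATION (Beukers 1979, n = 1, checked numerically to 1e-6 in the planner's folder): the
rational 3-fold Beukers integral equals `2(5ζ(3) − 6)`; as a five-rule statement between honest
representations: `[(0,1)³, (1−2x)(1−2y)/(1−(1−xy)z)] − 10·[(0,1)³, 1/(1−(1−xy)z)]·(1/2) …`; typed
here in the simplest kernel form: the combination below has value `0`, and the card predicts it
lies in `logClosure` by a derivation of bounded shape (partial fractions in `z`, log-primitive
Newton–Leibniz, `∫₀¹ xᵏ log x = −1/(k+1)²`). -/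
def BeukersWeightThreeCalibration : Prop :=
  ∀ (r s : KZ.IntegralRep 3) (u : KZ.IntegralRep 0),
    r.domain = {z | 0 < z 0 ∧ z 0 < 1 ∧ 0 < z 1 ∧ z 1 < 1 ∧ 0 < z 2 ∧ z 2 < 1} →
    EqOn r.integrand (fun z => (1 - 2 * z 0) * (1 - 2 * z 1) / (1 - (1 - z 0 * z 1) * z 2)) r.domain →
    s.domain = r.domain →
    EqOn s.integrand (fun z => 1 / (1 - (1 - z 0 * z 1) * z 2)) s.domain →
    u.domain = univ → EqOn u.integrand (fun _ => 1) u.domain →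
    KZ.of r - 5 • KZ.of s + 12 • KZ.of u ∈ logClosure

end Summit.KontsevichZagierPeriods.KontsevichZagierPeriods.Cruxes.LogKernelConjecture.DerivableSmallForms
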